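import Summits.BirchSwinnertonDyer.Rank1Residual.Partition.StrongPartial
import Summits.BirchSwinnertonDyer.Rank1Residual.X9.BigImageWitnesses
import Literature.NumberTheory.EllipticCurves.SkinnerUrban2014.SemistableCurvesProofs
import Literature.NumberTheory.EllipticCurves.ComplexMultiplicationNotSemistable
import HarnessLib

/-!
# The strong partial theorem on SEMISTABLE curves: at a good ORDINARY prime the only corner is the
# Eisenstein one (X1), and at `p ≥ 11` there is none — Skinner–Urban 2014 Cor. 3.6.10 ⊗ the Partition

HONEST FRAMING (cell `b2b-bsdres-*`, verbatim): the goal of the cell is to DELETE the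
COMBINATION-SHAPED residual classes for ALL analytic-rank ≤ 1 curves over ℚ — "full BSD formula
for every rank ≤ 1 curve in class C" assembled STRICTLY from published theorems — so that the
rank-≤1 remainder becomes exactly the CONSTRUCTION-SHAPED classes, which are TYPED (missing-input
Props), NOT attempted; this is not "finishing BSD".

Theorems only (no definition, no named fact).  Skinner–Urban, Invent. Math. 195 (2014), p. 45:
"the conditions on `E` in [Thm. 3.6.9] are always satisfied if `E` has semistable reduction and
`p ≥ 11`; in this case `ρ_{E,p}` is even surjective. The surjectivity follows from a celebrated
result of Mazur [Ma78] while the second condition [(ram)] follows easily from a result of Ribet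
[Ri91]. **Corollary 3.6.10.** If `E` is semistable and `p ≥ 11` is a prime of good ordinary
reduction, then the main conjecture holds for `E`."  The Literature file
`SkinnerUrban2014/SemistableCurvesProofs` PROVES both remarks over named facts already in the tree
(`mazur_torsion`; `exists_isNewformOf` + `diamond1995_refinedSerre` = Ribet 1990 Thm. 1.1 in
Diamond's form), at every ODD good `p` for the Ribet half.  Read through the cell's Partition
(`StrongPartial.bsdp_of_good_odd_of_not_corner`: the fourteen named published facts of the covered
rows ⟹ `BSD(E,p)` outside the seven corners `GoodOddCorner`), this gives:

* `classX1_of_goodOddCorner_of_semistable_of_goodOrd` — for `E` SEMISTABLE and `p` an odd prime of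
  good ORDINARY reduction, the only corner that can hold is X1 (Eisenstein anomalous): X6/X7/X8
  are supersingular, X9 is empty on semistable curves (Serre 1972 Prop. 21 i), x9 seat's
  `ClassX9.not_semistable`), X9im is empty because (irr) + the Ribet prime (ram) give (im)
  (`X9.bigIm_of_irr_of_ram`), and X10 is empty because Ribet supplies `Ram W 3`
  (`ram_of_semistable_of_irr` at `p = 3`; the rank-`1` disjunct of X10 asks `¬ Semistable W`).
* `residual_iff_classX1_of_semistable_of_goodOrd` / `not_residual_of_semistable_of_goodOrd_of_eleven_le`
  — on a semistable curve at an odd good ordinary prime the cell's residual disjunction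
  `Residual W p` (all fifteen class predicates) is EQUIVALENT to `ClassX1 W p`, and is FALSE at
  `p ≥ 11` (CM curves are never semistable, `not_semistable_of_hasCM`).
* `bsdp_of_semistable_of_goodOrd_of_irr` — **`BSD(E,p)` for every semistable `E/ℚ` of analytic
  rank `≤ 1` at every odd good ordinary `p` with `E[p]` irreducible** (fourteen facts + modularity
  + level-lowering).
* `bsdp_of_semistable_of_goodOrd_of_eleven_le` — **`BSD(E,p)` for every semistable `E/ℚ` of
  analytic rank `≤ 1` at every good ordinary prime `p ≥ 11`, NO corner** (adds Mazur's torsion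
  theorem `mazur_torsion`: Mazur 1978 Thm. 4 makes `E[p]` irreducible): Skinner–Urban's
  Cor. 3.6.10 / Remark (a) after Thm. 3.6.11 in BOTH analytic ranks, as a statement about Miller's
  `BSD(E,p)`.
* §Corners (appended; referee nit R126.3): the cell's class-level corollaries on semistable curves,
  moved here from §5 of the Literature file with unchanged signatures —
  `not_classX10_of_semistable` / `not_semistable_of_classX10` (**X10 ⊆ non-semistable curves**),
  `not_classX1_of_semistable_of_eleven_le`, `irr_surj_ram_of_semistable_of_eleven_le`.

Nothing is booked or relabelled by this file; the residual classes on semistable curves at good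
ordinary `p ∈ {3, 5, 7}` are exactly the X1 pairs (e.g. `11a1@5`).

References: Skinner–Urban 2014 Cor. 3.6.10 (p. 45), Remark (a) (p. 46); Mazur 1978 Thm. 4;
Mazur 1977 Thm. 8; Serre 1972 §5.4 Prop. 21; Ribet 1990 Thm. 1.1; Diamond 1995 Thm. 1.1;
`Partition/StrongPartial.lean` (p-accepted, `bsdp_of_good_odd_of_not_corner`).
-/

noncomputable section

namespace Summit.BirchSwinnertonDyer.Rank1Residual

open WeierstrassCurve Literature.NumberTheory.EllipticCurves
  Literature.NumberTheory.EllipticCurves.Rank1Residual Literature.NumberTheory.EllipticCurves.ModularForms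
  Literature.NumberTheory.EllipticCurves.SkinnerUrban2014 Literature.NumberTheory.Automorphic
open scoped NumberField

section Curve

open scoped Classical

variable {W : WeierstrassCurve ℚ} [W.IsElliptic] [W.IsGloballyMinimal] {p : ℕ} [Fact p.Prime]

/-- **On a SEMISTABLE curve at a prime of good ORDINARY reduction, the only corner is X1.**
Granted the Modularity Theorem (`hBCDT`, `exists_isNewformOf`) and level-lowering
(`hLL`, `diamond1995_refinedSerre`): if `E` is semistable, `p` is good ordinary and
`GoodOddCorner W p` holds, then `ClassX1 W p` (reducible anomalous) — X6/X7/X8 need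
supersingular reduction (or a non-semistable curve), X9 is empty on semistable curves
(`ClassX9.not_semistable`, Serre's Prop. 21 i)), X9im is empty because (irr) + Ribet's ramified
multiplicative prime give (im) (`ram_of_semistable_of_irr`, `X9.bigIm_of_irr_of_ram`), and X10 is
empty (rank `0`: Ribet supplies `Ram W 3`, `ram_of_semistable_of_irr`; rank `1`: X10 asks
`¬ Semistable W`).
[cite: SkinnerUrban2014, p. 45 (remark before Cor. 3.6.10)] [cite: Serre1972, §5.4 Prop. 21 i)]
[cite: Ribet1990, Thm. 1.1] -/
theorem classX1_of_goodOddCorner_of_semistable_of_goodOrd (hBCDT : exists_isNewformOf)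
    (hLL : diamond1995_refinedSerre) (hsst : Semistable W) (hord : GoodOrd W p)
    (hc : GoodOddCorner W p) : ClassX1 W p := by
  rcases hc with h | h | h | h | h | h | h
  · exact h
  · exact absurd h.1.2 hord.2
  · exact absurd hsst h.2
  · obtain ⟨rfl, hss, -⟩ := h
    exact absurd hss.2 hord.2
  · exact absurd hsst (ClassX9.not_semistable W p h)
  · obtain ⟨-, -, h5, hirr, hnb, -⟩ := h
    exact absurd (X9.bigIm_of_irr_of_ram W p hirr
      (ram_of_semistable_of_irr hBCDT hLL W p (by omega) hord.1 hsst hirr)) hnb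
  · obtain ⟨-, hord3, hirr3, h3⟩ := h
    rcases h3 with ⟨-, hnr⟩ | ⟨-, hns⟩
    · exact absurd (ram_of_semistable_of_irr hBCDT hLL W 3 (by decide) hord3.1 hsst hirr3) hnr
    · exact absurd hsst hns

/-- **No corner on a semistable curve at a good ordinary prime where `E[p]` is irreducible**
(X1 needs `E[p]` reducible). [cite: SkinnerUrban2014, p. 45 (remark before Cor. 3.6.10)] -/
theorem not_goodOddCorner_of_semistable_of_goodOrd_of_irr (hBCDT : exists_isNewformOf)
    (hLL : diamond1995_refinedSerre) (hsst : Semistable W) (hord : GoodOrd W p) (hirr : Irr W p) :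
    ¬ GoodOddCorner W p :=
  fun hc ↦ (classX1_of_goodOddCorner_of_semistable_of_goodOrd hBCDT hLL hsst hord hc).2.1 hirr

/-- **No corner on a semistable curve at a good ordinary prime `p ≥ 11`** (Mazur 1978 Thm. 4,
granted `mazur_torsion`: `E[p]` is irreducible). [cite: SkinnerUrban2014, Cor. 3.6.10 (p. 45)]
[cite: Mazur1978, Thm. 4 (p. 131)] -/
theorem not_goodOddCorner_of_semistable_of_goodOrd_of_eleven_le (hBCDT : exists_isNewformOf)
    (hLL : diamond1995_refinedSerre) (hMaz : ∀ V : WeierstrassCurve ℚ, mazur_torsion V)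
    (hsst : Semistable W) (hord : GoodOrd W p) (h11 : 11 ≤ p) : ¬ GoodOddCorner W p :=
  not_goodOddCorner_of_semistable_of_goodOrd_of_irr hBCDT hLL hsst hord
    (irr_of_semistable_of_eleven_le W p hMaz hsst h11)

/-- **On a SEMISTABLE curve at an odd prime of good ORDINARY reduction, the residual disjunction
of the cell IS the Eisenstein corner X1**: `Residual W p ↔ ClassX1 W p` (the other good-prime
corners are empty by `classX1_of_goodOddCorner_of_semistable_of_goodOrd`, and the CM class X12 is
empty because a CM curve over `ℚ` is never semistable, `not_semistable_of_hasCM`).  Granted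
modularity and level-lowering. [cite: SkinnerUrban2014, p. 45 (remark before Cor. 3.6.10)]
[cite: SilvermanATAEC1994, Thm. II.6.4 (CM ⇒ potentially good reduction everywhere)] -/
theorem residual_iff_classX1_of_semistable_of_goodOrd (hBCDT : exists_isNewformOf)
    (hLL : diamond1995_refinedSerre) (hp : p ≠ 2) (hsst : Semistable W) (hord : GoodOrd W p) :
    Residual W p ↔ ClassX1 W p := by
  constructor
  · intro h
    rcases (residual_iff_goodOddCorner_or_classX12 hp hord.1).1 h with hc | h12
    · exact classX1_of_goodOddCorner_of_semistable_of_goodOrd hBCDT hLL hsst hord hc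
    · exact absurd hsst (Rank1Residual.not_semistable_of_hasCM W h12.1)
  · exact fun h1 ↦ (residual_iff_goodOddCorner_or_classX12 hp hord.1).2 (Or.inl (Or.inl h1))

/-- **On a SEMISTABLE curve at a good ORDINARY prime `p ≥ 11`, NO residual class of the cell
holds** (`¬ Residual W p`): X1 is excluded by Mazur 1978 Thm. 4 (`hMaz`). Granted modularity,
level-lowering and Mazur's torsion theorem.
[cite: SkinnerUrban2014, Cor. 3.6.10 (p. 45)] [cite: Mazur1978, Thm. 4 (p. 131)] -/
theorem not_residual_of_semistable_of_goodOrd_of_eleven_le (hBCDT : exists_isNewformOf)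
    (hLL : diamond1995_refinedSerre) (hMaz : ∀ V : WeierstrassCurve ℚ, mazur_torsion V)
    (hsst : Semistable W) (hord : GoodOrd W p) (h11 : 11 ≤ p) : ¬ Residual W p := fun h ↦
  ((residual_iff_classX1_of_semistable_of_goodOrd hBCDT hLL (by omega) hsst hord).1 h).2.1
    (irr_of_semistable_of_eleven_le W p hMaz hsst h11)

/-- **`BSD(E,p)` for every SEMISTABLE `E/ℚ` of analytic rank `≤ 1` at every odd prime `p` of good
ORDINARY reduction with `E[p]` irreducible.**  Granted the fourteen named published facts of the
covered rows (as in `bsdp_of_good_odd_of_not_corner`), the Modularity Theorem (`hBCDT`) and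
level-lowering (`hLL`): the corner hypothesis of the strong partial theorem is DISCHARGED on
semistable curves (`not_goodOddCorner_of_semistable_of_goodOrd_of_irr`).  Rank `0` is Skinner–Urban
Thm. 3.6.11 (a) / Skinner 2016 Thm. C with (ram) supplied by Ribet and surjectivity by Serre's
Prop. 21; rank `1` is Jetchev–Skinner–Wan 2017 Thm. 1.2.1 (row C3).
[cite: SkinnerUrban2014, Thm. 3.6.11 and Remark (a) (p. 46)] [cite: Skinner2016PacificMC, Thm. C, §2.5]
[cite: JetchevSkinnerWan2017, Thm. 1.2.1] -/
theorem bsdp_of_semistable_of_goodOrd_of_irr (hSk : Skinner2016.thmC_padicValRat_bsd_rank_zero)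
    (hBCS : BurungaleCastellaSkinner2025.cor131_padicValRat_bsd_rank_le_one)
    (hJSW : JetchevSkinnerWan2017.thm121_padicValRat_bsd_rank_one)
    (hCGS : CastellaGrossiSkinner2025.thmD_padicValRat_bsd_rank_le_one)
    (hGV : GreenbergVatsal2000.thm13_charIdeal_eq_of_gvPar) (hGr : greenberg_charValue_rankZero)
    (hmod : hasEntireLFunction_rat) (hmodP : nonempty_modularParametrizationData)
    (hGZK : rank_eq_analyticRank_of_analyticRank_le_one)
    (hCM : bsdTriple_of_hasCM_of_L_one_ne_zero) (hKob : Kobayashi2013.cor14_bsdp_of_cm_rank_one)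
    (hYZ : YanZhu2026.thm415_padicValRat_bsd_rank_le_one)
    (hW20 : Wuthrich2014.lemma20_surjective_threeAdic_of_semistable)
    (hLLT : LiLiuTian2024.thm11_bsdp_of_cm_rank_one)
    (hBCDT : exists_isNewformOf) (hLL : diamond1995_refinedSerre)
    (hr : W.analyticRank ≤ 1) (hp : p ≠ 2) (hsst : Semistable W) (hord : GoodOrd W p)
    (hirr : Irr W p) : BSDp W p :=
  bsdp_of_good_odd_of_not_corner hSk hBCS hJSW hCGS hGV hGr hmod hmodP hGZK hCM hKob hYZ hW20 hLLT hr
    hp hord.1 (not_goodOddCorner_of_semistable_of_goodOrd_of_irr hBCDT hLL hsst hord hirr)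

/-- **`BSD(E,p)` for every SEMISTABLE `E/ℚ` of analytic rank `≤ 1` at every prime `p ≥ 11` of
good ORDINARY reduction — no corner, no image or (ram) hypothesis** (Skinner–Urban 2014,
Cor. 3.6.10 and Remark (a) after Thm. 3.6.11, in both analytic ranks, as a statement about
Miller's `BSD(E,p)`).  Granted the fourteen named published facts of the covered rows, the
Modularity Theorem (`hBCDT`), level-lowering (`hLL`, Ribet 1990 / Diamond 1995) and Mazur's torsion
theorem (`hMaz`): `E[p]` is irreducible by Mazur 1978 Thm. 4 (`irr_of_semistable_of_eleven_le`),
and then `bsdp_of_semistable_of_goodOrd_of_irr`.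
[cite: SkinnerUrban2014, Cor. 3.6.10 (p. 45) and Remark (a) (p. 46)] [cite: Mazur1978, Thm. 4 (p. 131)]
[cite: Ribet1990, Thm. 1.1] -/
theorem bsdp_of_semistable_of_goodOrd_of_eleven_le
    (hSk : Skinner2016.thmC_padicValRat_bsd_rank_zero)
    (hBCS : BurungaleCastellaSkinner2025.cor131_padicValRat_bsd_rank_le_one)
    (hJSW : JetchevSkinnerWan2017.thm121_padicValRat_bsd_rank_one)
    (hCGS : CastellaGrossiSkinner2025.thmD_padicValRat_bsd_rank_le_one)
    (hGV : GreenbergVatsal2000.thm13_charIdeal_eq_of_gvPar) (hGr : greenberg_charValue_rankZero)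
    (hmod : hasEntireLFunction_rat) (hmodP : nonempty_modularParametrizationData)
    (hGZK : rank_eq_analyticRank_of_analyticRank_le_one)
    (hCM : bsdTriple_of_hasCM_of_L_one_ne_zero) (hKob : Kobayashi2013.cor14_bsdp_of_cm_rank_one)
    (hYZ : YanZhu2026.thm415_padicValRat_bsd_rank_le_one)
    (hW20 : Wuthrich2014.lemma20_surjective_threeAdic_of_semistable)
    (hLLT : LiLiuTian2024.thm11_bsdp_of_cm_rank_one)
    (hBCDT : exists_isNewformOf) (hLL : diamond1995_refinedSerre)
    (hMaz : ∀ V : WeierstrassCurve ℚ, mazur_torsion V)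
    (hr : W.analyticRank ≤ 1) (hsst : Semistable W) (h11 : 11 ≤ p) (hord : GoodOrd W p) :
    BSDp W p :=
  bsdp_of_semistable_of_goodOrd_of_irr hSk hBCS hJSW hCGS hGV hGr hmod hmodP hGZK hCM hKob hYZ hW20
    hLLT hBCDT hLL hr (by omega) hsst hord (irr_of_semistable_of_eleven_le W p hMaz hsst h11)

end Curve

/-! ## Corner predicates on semistable curves (the cell's class-level corollaries of S–U p. 45)

The three cell-vocabulary corollaries that lived in §5 of the Literature file
`Literature/NumberTheory/EllipticCurves/SkinnerUrban2014/SemistableCurvesProofs.lean` belong on the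
Summits side (referee nit R126.3 / R128.6 / R129.7, "deprecate-and-add into `Partition/SemistableCurves`"):
they are restated here under `Summit.BirchSwinnertonDyer.Rank1Residual` names with the SAME
signatures (explicit `W`, `p`), so that a consumer migrates by dropping the `SkinnerUrban2014.`
prefix; their proofs are the published inputs of §1–§2 of the Literature file (Mazur 1978 Thm. 4 via
`irr_of_semistable_of_eleven_le`; Ribet 1990 / Diamond 1995 via `ram_of_semistable_of_irr`), which
stay where they are.  `not_semistable_of_classX10` is the display form "X10 ⊆ non-semistable
curves" (R126.3).  Theorems only; nothing booked; the X10 label is unchanged. -/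

section Corners

variable (W : WeierstrassCurve ℚ) [W.IsElliptic] [W.IsGloballyMinimal] (p : ℕ) [Fact p.Prime]

/-- **On a semistable curve class X10 is EMPTY (both ranks)**: `ClassX10 W p` (`p = 3` good
ordinary, `E[3]` irreducible, and `(r = 0 ∧ ¬ Ram W 3) ∨ (r = 1 ∧ ¬ Semistable W)`) fails for
semistable `E` — the rank-`1` disjunct by definition, the rank-`0` disjunct because Ribet's
level-lowering at `p = 3` supplies `Ram W 3` (`ram_of_semistable_of_irr`).  Granted modularity
(`hmod`) and level-lowering (`hLL`).
[cite: SkinnerUrban2014, p. 45 (remark before Cor. 3.6.10)] [cite: Ribet1990, Thm. 1.1] -/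
theorem not_classX10_of_semistable (hmod : exists_isNewformOf) (hLL : diamond1995_refinedSerre)
    (hsst : Semistable W) : ¬ ClassX10 W p := by
  rintro ⟨rfl, hord, hirr, h⟩
  rcases h with ⟨-, hnr⟩ | ⟨-, hns⟩
  · exact hnr (ram_of_semistable_of_irr hmod hLL W 3 (by decide) hord.1 hsst hirr)
  · exact hns hsst

/-- **X10 ⊆ non-semistable curves**: a curve in class X10 at `p` is NOT semistable (display form of
`not_classX10_of_semistable`; granted modularity and level-lowering).
[cite: SkinnerUrban2014, p. 45 (remark before Cor. 3.6.10)] [cite: Ribet1990, Thm. 1.1] -/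
theorem not_semistable_of_classX10 (hmod : exists_isNewformOf) (hLL : diamond1995_refinedSerre)
    (h : ClassX10 W p) : ¬ Semistable W :=
  fun hsst ↦ not_classX10_of_semistable W p hmod hLL hsst h

/-- **On a semistable curve class X1 is EMPTY at `p ≥ 11`**: X1 asks `E[p]` reducible, but
Mazur 1978 Thm. 4 (granted `mazur_torsion`, `irr_of_semistable_of_eleven_le`) makes it irreducible.
[cite: Mazur1978, Thm. 4 (p. 131)] -/
theorem not_classX1_of_semistable_of_eleven_le (hMT : ∀ V : WeierstrassCurve ℚ, mazur_torsion V)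
    (hsst : Semistable W) (h11 : 11 ≤ p) : ¬ ClassX1 W p :=
  fun h ↦ h.2.1 (irr_of_semistable_of_eleven_le W p hMT hsst h11)

/-- **On a semistable curve, at a good prime `p ≥ 11`, `E[p]` is irreducible, `ρ̄_{E,p}` is onto
and (ram) holds** — the three hypotheses of Skinner–Urban Thm. 2 / Skinner 2016 Thm. C / bsd.S30
in the cell's predicates, all automatic (S–U p. 45: Mazur 1978 Thm. 4, Serre 1972 Prop. 21,
Ribet 1990 Thm. 1.1).  Granted modularity, level-lowering and Mazur's torsion theorem.
[cite: SkinnerUrban2014, p. 45 (remark before Cor. 3.6.10)] -/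
theorem irr_surj_ram_of_semistable_of_eleven_le (hmod : exists_isNewformOf)
    (hLL : diamond1995_refinedSerre) (hMT : ∀ V : WeierstrassCurve ℚ, mazur_torsion V)
    (hsst : Semistable W) (h11 : 11 ≤ p) (hgood : Good W p) :
    Irr W p ∧ Surj W p ∧ Ram W p :=
  have hirr := irr_of_semistable_of_eleven_le W p hMT hsst h11
  ⟨hirr, surj_of_irr_of_semistable W p hirr hsst,
    ram_of_semistable_of_irr hmod hLL W p (by omega) hgood hsst hirr⟩

end Corners

end Summit.BirchSwinnertonDyer.Rank1Residual

end
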